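import Summits.QuantumFields.BalabanUV.T4Continuum.Spine.NE7cSmoothingSocket

/-!
# T⁴ programme, spine node NE7c (U5b) — ROAD P3 «SMOOTHING»: WHERE THE WINDOW SHELL IS LOAD-BEARING — the remainder
# sandwich `hsw` LOCALISED to each term's joint polarity event (kernel), and the letterless certificate for the global form

Cell `pub-balaban`, BINDER-OWNERS row NE7c, co-owner #3 = unit `b2b-balaban-t4-ne7c-p3` (GEN 2), skeleton
`HOME/t4/skeletons/NE7c-t4-ne7c-p3.md` §1/§4.  Companion of `Spine/NE7cSmoothing` (p206673), `Spine/NE7cSmoothingSocket`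
(p207756).  A LOCATED FINDING about the cell's own (η)/(o1) chain, typed, with its repair — nothing of Bałaban's asserted.

THE FINDING.  In the layer model `T4PatternLayer.layerX₂` (pv07) the declared young letters multiply a PATTERN-FREE remainder
(`R K t τ.1`), so over each older history the `2^{m₀}` pattern terms RESUM to the letter-free weight (`sum_patterns_layerX₂`, in
tree).  The end-to-end faces `T4LipschitzLedger.cauchy_of_repr` / `T4PatternLayer.cauchy_of_finest_patterned` take node U5b's
remainder sandwich `hsw` GLOBALLY (a.e. on the whole window field space, per good term).  With that binder the letters are INERT:
§3 `cauchy_letterless` — the SAME Cauchy conclusion from `hW` (NE7b) + global `hsw` (U5b) + `δ` + positivity with NO declared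
letter, NO (F∞)/NE3 input at the window and shell weight `0` (it is `cauchy_of_finest_patterned` at `m₀ ≡ 0`, by name).  So, AS
TYPED, the window's indicator shell — the root `ShellWeightBound` of row NE7c for the layer families, on every road — pays for a
split that the global `hsw` makes unnecessary.

THE REPAIR (what makes NE7c load-bearing, and what a supplier of `hsw` can actually hope to deliver).  Localise `hsw` to each
good term's JOINT POLARITY EVENT: the remainders need to be sandwiched only at window configurations `v` where EVERY declared
letter of the term is «on» in BOTH runs (`facAt … u^A … i ≠ 0 ∧ facAt … u^B … i ≠ 0` for all `i < m`; for a small-field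
letter this reads `u^A_i < θ_i ∧ u^B_i < θ_i` — the COMMON SMALL-FIELD REGION, where analytic control lives —, for a
large-field letter `u^X_i > (1 − κ_a)θ_i`, §1).  Off that event the common min-core VANISHES, so the core pieces are still
sandwiched (§2 `core_sandwich_local`, the localised twin of `T4LipschitzLedger.core_sandwich`), and the full chain goes through
unchanged: `cauchy_of_repr_local` (generic ledger) and, for the (η)-layer of the two runs with (F∞) from node U1b,
`coreSandwich_layer_local_of_localRate` (the `hcore`/`core` datum of `T4IndicatorShell.cauchy_of_relWeightBound_shell` /
`T4MatchingAssembly.HybridNE7` for the layer families from the LOCALISED old-density sandwich).  With the localised binder the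
letters are NOT inert (the events depend on the pattern), the complement of the joint events is exactly what the shell parts
carry, and R = `ShellWeightBound` is the price of the localisation — summable by END-W/END-R.

HONEST FRAMING.  Kernel bookkeeping ([folklore], 0 sorry).  The localised `hsw` is a BINDER (node U5b's, supplier pv07's
successor); this module changes its SHAPE (weaker hypothesis, same conclusions), asserts nothing about Bałaban's densities, and
does not decide whether print's young T-operations make the remainder pattern-DEPENDENT (then the letters are not inert even
globally — an (o1)-instantiation question, NODE O).  FIXED finite T⁴, rung (B)+1; NOT infinite volume, NOT a mass gap, NOT
Clay, NOT summit progress; spine 0/9.  HONEST DEPENDENCY: continuum YM on T⁴ ⇐ BetaPertH ∧ nine spine estimates (0/9 proved);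
BetaPertH ⇐ (D1) ∧ (D4) ∧ CAP+tail; G-an2-4 gates asym, D1 and NE2/3/4.
-/

noncomputable section

open MeasureTheory Finset Filter
open scoped NNReal ENNReal

namespace Summit.QuantumFields.BalabanUV.T4Continuum.NE7cSmoothingLocal

open Literature.MathematicalPhysics.QuantumFieldTheory.Balaban1983to89
open T4Continuum T4LevelShift T4AveragingDisintegration T4WindowLevelShift T4LipschitzLedger T4FiniteEpsInhabited
  BlockAveraging ExpMeanLog T4FinestToWindow T4AgeZeroLayer T4PatternLayer T4SupCloseLiaison T4EtaRateMin
open T4IndicatorShell T4LipschitzCutoff T4WeightBudget T4HybridMatching T4MatchingAssembly T4CauchySum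
open Summit.QuantumFields.BalabanUV.T4Continuum.NE7cSmoothing Summit.QuantumFields.BalabanUV.T4Continuum.NE7cSmoothingSocket

/-! ## §1 Reading the joint polarity event: what `facAt … ≠ 0` says about the tested variable -/

section Event

variable {χ : ℕ → ℝ → ℝ} {κ Lχ : ℕ → ℝ} {sl : ℕ → Σ _ : ℕ, ℕ} {pol : ℕ → Pol} {θ u uA uB : ℕ → ℝ} {m : ℕ}

/-- A SMALL-field letter that is «on» puts the tested variable strictly below threshold: `χ_a(u/θ) ≠ 0 ⇒ u < θ`
(`LipProfile.lt_one_of_ne_zero`). [folklore] -/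
theorem lt_thr_of_facAt_ne_zero_small (hχ : ∀ a, LipProfile (χ a) (κ a) (Lχ a)) {i : ℕ} (hθ : 0 < θ i)
    (hpol : pol i = Pol.small) (h : facAt χ sl pol θ u i ≠ 0) : u i < θ i := by
  unfold facAt at h
  rw [hpol, Pol.fac_small] at h
  have := (hχ _).lt_one_of_ne_zero h
  rwa [div_lt_one hθ] at this

/-- A LARGE-field letter that is «on» puts the tested variable strictly above the lowered threshold:
`1 − χ_a(u/θ) ≠ 0 ⇒ (1 − κ_a)θ < u` (`LipProfile.eq_one`). [folklore] -/
theorem lt_of_facAt_ne_zero_large (hχ : ∀ a, LipProfile (χ a) (κ a) (Lχ a)) {i : ℕ} (hθ : 0 < θ i)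
    (hpol : pol i = Pol.large) (h : facAt χ sl pol θ u i ≠ 0) : (1 - κ (sl i).1) * θ i < u i := by
  unfold facAt at h
  rw [hpol, Pol.fac_large] at h
  by_contra hle
  have hle : u i ≤ (1 - κ (sl i).1) * θ i := not_lt.1 hle
  have h1 : u i / θ i ≤ 1 - κ (sl i).1 := by rw [div_le_iff₀ hθ]; exact hle
  exact h (by rw [(hχ _).eq_one _ h1, sub_self])

/-- Where the common min-core does not vanish, EVERY declared letter is «on» in BOTH runs. [folklore] -/
theorem facAt_ne_zero_of_coreAt_ne_zero (hχ : ∀ a, LipProfile (χ a) (κ a) (Lχ a))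
    (h : coreAt χ sl pol θ uA uB m ≠ 0) :
    ∀ i < m, facAt χ sl pol θ uA i ≠ 0 ∧ facAt χ sl pol θ uB i ≠ 0 := by
  intro i hi
  unfold coreAt at h
  have hmin : min (facAt χ sl pol θ uA i) (facAt χ sl pol θ uB i) ≠ 0 :=
    (Finset.prod_ne_zero_iff.1 h) i (mem_range.2 hi)
  constructor
  · intro h0
    apply hmin
    exact le_antisymm (by rw [← h0]; exact min_le_left _ _) (le_min (facAt_nonneg hχ i) (facAt_nonneg hχ i))
  · intro h0
    apply hmin
    exact le_antisymm (by rw [← h0]; exact min_le_right _ _) (le_min (facAt_nonneg hχ i) (facAt_nonneg hχ i))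

end Event

/-! ## §2 The localised remainder sandwich ⇒ the core sandwich (generic Lipschitz ledger) -/

section Local

/-- **SANDWICH OF INTEGRALS AGAINST A NONNEGATIVE WEIGHT, HYPOTHESES ONLY ON THE WEIGHT'S SUPPORT**: if
`e^{c−r} R^A ≤ R^B ≤ e^{c+r} R^A` holds a.e. WHERE `f ≠ 0`, and `f ≥ 0`, then `e^{c−r}∫ f R^A ≤ ∫ f R^B ≤ e^{c+r}∫ f R^A`
(the localised twin of `T4LipschitzLedger.integral_mul_sandwich`). [folklore] -/
theorem integral_mul_sandwich_on {α : Type*} [MeasurableSpace α] {ν : Measure α} {f RA' RB' : α → ℝ} {c r : ℝ}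
    (hf0 : ∀ v, 0 ≤ f v) (hIA : Integrable (fun v => f v * RA' v) ν) (hIB : Integrable (fun v => f v * RB' v) ν)
    (hlo : ∀ᵐ v ∂ν, f v ≠ 0 → Real.exp (c - r) * RA' v ≤ RB' v)
    (hhi : ∀ᵐ v ∂ν, f v ≠ 0 → RB' v ≤ Real.exp (c + r) * RA' v) :
    Real.exp (c - r) * ∫ v, f v * RA' v ∂ν ≤ ∫ v, f v * RB' v ∂ν ∧
      ∫ v, f v * RB' v ∂ν ≤ Real.exp (c + r) * ∫ v, f v * RA' v ∂ν := by
  refine integral_sandwich hIA hIB ?_ ?_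
  · filter_upwards [hlo] with v hv
    by_cases h0 : f v = 0
    · simp [h0]
    · calc Real.exp (c - r) * (f v * RA' v) = f v * (Real.exp (c - r) * RA' v) := by ring
        _ ≤ f v * RB' v := mul_le_mul_of_nonneg_left (hv h0) (hf0 v)
  · filter_upwards [hhi] with v hv
    by_cases h0 : f v = 0
    · simp [h0]
    · calc f v * RB' v ≤ f v * (Real.exp (c + r) * RA' v) := mul_le_mul_of_nonneg_left (hv h0) (hf0 v)
        _ = Real.exp (c + r) * (f v * RA' v) := by ring

variable {ι : Type*} {Ω : ℕ → ι → Type*} [∀ K τ, MeasurableSpace (Ω K τ)]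
  {l₀ vol : ℝ} {T : ℕ → Finset ι} {A B : ℕ → ℝ → ι → ℝ} {χ : ℕ → ℝ → ℝ} {κ Lχ : ℕ → ℝ} {N : ℕ} {n : ℕ → ℕ}
  {μ : (K : ℕ) → (τ : ι) → Measure (Ω K τ)} {m : ℕ → ι → ℕ} {slot : ℕ → ι → ℕ → Σ _ : ℕ, ℕ}
  {pol : ℕ → ι → ℕ → Pol} {θ : ℕ → ι → ℕ → ℝ} {uA uB : (K : ℕ) → (τ : ι) → ℕ → Ω K τ → ℝ}
  {RA RB : (K : ℕ) → ℝ → (τ : ι) → Ω K τ → ℝ} {ρ S W δ : ℕ → ℝ} {Bad : ℕ → ℝ → Finset ι}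

/-- **THE CORE SANDWICH FROM THE LOCALISED REMAINDER SANDWICH.**  If on every good term the two runs' remainders are
sandwiched a.e. ON THE TERM'S JOINT POLARITY EVENT — `e^{c_K − vol·δ_K} R^A ≤ R^B ≤ e^{c_K + vol·δ_K} R^A` at every `v`
where all declared letters are «on» in both runs —, then the core pieces `A − shellW^A`, `B − shellW^B` are sandwiched with the
same constants: off the event the common min-core vanishes (`facAt_ne_zero_of_coreAt_ne_zero`).  Localised twin of
`T4LipschitzLedger.core_sandwich` (whose `hsw` is a.e. on the WHOLE window space); same conclusion, weaker binder. [folklore] -/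
theorem core_sandwich_local [DecidableEq ι] (hA : TermRepr l₀ T A χ κ Lχ N n μ m slot pol θ uA uB RA)
    (hB : TermRepr l₀ T B χ κ Lχ N n μ m slot pol θ uB uA RB) {c : ℕ → ℝ}
    (hswL : ∀ K t, |t| ≤ l₀ → ∀ τ ∈ T K \ Bad K t,
      (∀ᵐ v ∂(μ K τ), (∀ i < m K τ, facAt χ (slot K τ) (pol K τ) (θ K τ) (fun j => uA K τ j v) i ≠ 0 ∧
          facAt χ (slot K τ) (pol K τ) (θ K τ) (fun j => uB K τ j v) i ≠ 0) →
        Real.exp (c K - vol * δ K) * RA K t τ v ≤ RB K t τ v) ∧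
      (∀ᵐ v ∂(μ K τ), (∀ i < m K τ, facAt χ (slot K τ) (pol K τ) (θ K τ) (fun j => uA K τ j v) i ≠ 0 ∧
          facAt χ (slot K τ) (pol K τ) (θ K τ) (fun j => uB K τ j v) i ≠ 0) →
        RB K t τ v ≤ Real.exp (c K + vol * δ K) * RA K t τ v)) :
    ∀ K : ℕ, ∃ c' : ℝ, ∀ t : ℝ, |t| ≤ l₀ → ∀ τ ∈ T K \ Bad K t,
      Real.exp (c' - vol * δ K) * (A K t τ - shellW χ μ m slot pol θ uA uB RA K t τ) ≤
          B K t τ - shellW χ μ m slot pol θ uB uA RB K t τ ∧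
        B K t τ - shellW χ μ m slot pol θ uB uA RB K t τ ≤
          Real.exp (c' + vol * δ K) * (A K t τ - shellW χ μ m slot pol θ uA uB RA K t τ) := by
  intro K
  refine ⟨c K, fun t ht τ hτ => ?_⟩
  have hτT : τ ∈ T K := (Finset.mem_sdiff.1 hτ).1
  obtain ⟨hlo, hhi⟩ := hswL K t ht τ hτ
  have hIB : Integrable (fun v => coreAt χ (slot K τ) (pol K τ) (θ K τ) (fun j => uA K τ j v) (fun j => uB K τ j v)
      (m K τ) * RB K t τ v) (μ K τ) := by
    refine (hB.integrable_core ht hτT (K := K)).congr (ae_of_all _ fun v => ?_)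
    simp only
    rw [coreAt_comm]
  rw [hA.repr_sub_shellW K t ht τ hτT, hB.repr_sub_shellW K t ht τ hτT,
    coreW_comm (uA := uA) (uB := uB) (RB := RB) K t τ]
  unfold coreW
  refine integral_mul_sandwich_on (fun v => coreAt_nonneg hA.profile) (hA.integrable_core ht hτT) hIB ?_ ?_
  · filter_upwards [hlo] with v hv hne
    exact hv (facAt_ne_zero_of_coreAt_ne_zero hA.profile hne)
  · filter_upwards [hhi] with v hv hne
    exact hv (facAt_ne_zero_of_coreAt_ne_zero hA.profile hne)

/-- **END TO END UNDER DESIGN (η) WITH THE LOCALISED REMAINDER SANDWICH** (the localised twin of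
`T4LipschitzLedger.cauchy_of_repr`: identical binders except `hsw` ↦ `hswL`; identical conclusions).  Here the declared
letters are NOT inert: the complement of the joint events is carried by the shell parts, whose weight `ShellWeightBound`
(`shellWeightBound_of_repr`) is the price of the localisation. [folklore] -/
theorem cauchy_of_repr_local [DecidableEq ι] {Z : ℕ → ℝ → ℝ} (hvol : 0 < vol) (hl₀ : 0 ≤ l₀)
    (hW : RelWeightBound l₀ T A B Bad W)
    (hA : TermRepr l₀ T A χ κ Lχ N n μ m slot pol θ uA uB RA) (hB : TermRepr l₀ T B χ κ Lχ N n μ m slot pol θ uB uA RB)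
    (hF : SupClose T μ m slot θ uA uB ρ)
    (hSA : SiblingSuppression l₀ T A N n (sibW χ κ μ m slot pol θ uA RA ρ) S)
    (hSB : SiblingSuppression l₀ T B N n (sibW χ κ μ m slot pol θ uB RB ρ) S)
    (hS : ∀ a ≤ N, 0 ≤ S a) (hρ0 : ∀ j, 0 ≤ ρ j) (hρ : Summable ρ)
    (hlt : ∀ K, W K + ∑ a ∈ range (N + 1), (n a : ℝ) * lipWeight Lχ S ρ a K < 1)
    (hZA : ∀ K t, |t| ≤ l₀ → Z K t = ∑ τ ∈ T K, A K t τ)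
    (hZB : ∀ K t, |t| ≤ l₀ → Z (K + 1) t = ∑ τ ∈ T K, B K t τ)
    (hpos : ∀ K t, |t| ≤ l₀ → 0 < ∑ τ ∈ T K, A K t τ) (hδ : Summable δ) {c : ℕ → ℝ}
    (hswL : ∀ K t, |t| ≤ l₀ → ∀ τ ∈ T K \ Bad K t,
      (∀ᵐ v ∂(μ K τ), (∀ i < m K τ, facAt χ (slot K τ) (pol K τ) (θ K τ) (fun j => uA K τ j v) i ≠ 0 ∧
          facAt χ (slot K τ) (pol K τ) (θ K τ) (fun j => uB K τ j v) i ≠ 0) →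
        Real.exp (c K - vol * δ K) * RA K t τ v ≤ RB K t τ v) ∧
      (∀ᵐ v ∂(μ K τ), (∀ i < m K τ, facAt χ (slot K τ) (pol K τ) (θ K τ) (fun j => uA K τ j v) i ≠ 0 ∧
          facAt χ (slot K τ) (pol K τ) (θ K τ) (fun j => uB K τ j v) i ≠ 0) →
        RB K t τ v ≤ Real.exp (c K + vol * δ K) * RA K t τ v)) :
    MatchingModConstants vol l₀
        (hybridDelta vol δ (fun K => W K + ∑ a ∈ range (N + 1), (n a : ℝ) * lipWeight Lχ S ρ a K)) Z ∧
      Summable (hybridDelta vol δ (fun K => W K + ∑ a ∈ range (N + 1), (n a : ℝ) * lipWeight Lχ S ρ a K)) ∧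
      (∀ t : ℝ, |t| ≤ l₀ → CauchySeq fun K => genFun Z K t) ∧
      TendstoUniformlyOn (fun K t => genFun Z K t) (genFunLim Z) atTop {t | |t| ≤ l₀} :=
  cauchy_of_relWeightBound_shell hvol hl₀ hW (shellWeightBound_of_repr hA hB hF hSA hSB hS hρ0 hρ) hlt hZA hZB hpos hδ
    (core_sandwich_local hA hB hswL)

end Local

/-! ## §3 The letterless certificate: with the GLOBAL remainder sandwich the declared letters are inert -/

section Letterless

variable {ι₀ : Type*} [DecidableEq ι₀] {N : ℕ} [NeZero N] (F : T4Family)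

/-- **THE SAME CAUCHY CONCLUSION WITH NO DECLARED LETTER** (`T4PatternLayer.cauchy_of_finest_patterned` at `m₀ ≡ 0`, BY NAME).
Binders: older histories `T₀` with window depths `NW₀ τ' ≤ K`; finest-level weights `R_A`, `R_B` (a.e. nonnegative, integrable);
row NE7b's `RelWeightBound` on the letter-free weights `fixW` (= `∫ R_X`); the partition-function identities and positivity;
summable `δ`; node U5b's GLOBAL old-density sandwich `hsw` — and NOTHING ELSE: no profile with content, no slot, no threshold,
no window functional, no (F∞)/NE3 rate, shell weight `0`.  READING: as long as `hsw` is the global a.e. sandwich, the (η)-layer's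
young letters change nothing in the conclusion — the window's indicator shell is self-inflicted; §2's localised `hswL` is the
binder under which it is not. [folklore] -/
theorem cauchy_letterless {l₀ vol : ℝ} {T₀ : ℕ → Finset ι₀} {Bad₀ : ℕ → ℝ → Finset ι₀} {W δ : ℕ → ℝ}
    {NW₀ : ι₀ → ℕ} (hNW : ∀ K, ∀ τ' ∈ T₀ K, NW₀ τ' ≤ K)
    {RA : (K : ℕ) → ℝ → ι₀ → GaugeField (F.P K) 0 (SU N) → ℝ}
    {RB : (K : ℕ) → ℝ → ι₀ → GaugeField (F.P (K + 1)) 0 (SU N) → ℝ}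
    (hRA0 : ∀ K t, |t| ≤ l₀ → ∀ τ' ∈ T₀ K, 0 ≤ᵐ[fieldMeasure (F.P K) 0 (SU N)] RA K t τ')
    (hRAi : ∀ K t, |t| ≤ l₀ → ∀ τ' ∈ T₀ K, Integrable (RA K t τ') (fieldMeasure (F.P K) 0 (SU N)))
    (hRB0 : ∀ K t, |t| ≤ l₀ → ∀ τ' ∈ T₀ K, 0 ≤ᵐ[fieldMeasure (F.P (K + 1)) 0 (SU N)] RB K t τ')
    (hRBi : ∀ K t, |t| ≤ l₀ → ∀ τ' ∈ T₀ K, Integrable (RB K t τ') (fieldMeasure (F.P (K + 1)) 0 (SU N)))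
    (hW : RelWeightBound l₀ T₀
      (fixW F (fun _ => linProfile (1 / 2)) NW₀ (fun _ _ => 0) (fun _ _ => 0) (fun _ _ _ => ⟨0, 0⟩) (fun _ _ _ => Pol.small)
        (fun _ _ _ => 1) (fun _ _ _ _ => 0) (fun K => K) RA)
      (fixW F (fun _ => linProfile (1 / 2)) NW₀ (fun _ _ => 0) (fun _ _ => 0) (fun _ _ _ => ⟨0, 0⟩) (fun _ _ _ => Pol.small)
        (fun _ _ _ => 1) (fun _ _ _ _ => 0) (fun K => K + 1) RB) Bad₀ W)
    (hvol : 0 < vol) (hl₀ : 0 ≤ l₀) {Z : ℕ → ℝ → ℝ}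
    (hZA : ∀ K t, |t| ≤ l₀ → Z K t = ∑ τ' ∈ T₀ K,
      fixW F (fun _ => linProfile (1 / 2)) NW₀ (fun _ _ => 0) (fun _ _ => 0) (fun _ _ _ => ⟨0, 0⟩) (fun _ _ _ => Pol.small)
        (fun _ _ _ => 1) (fun _ _ _ _ => 0) (fun K => K) RA K t τ')
    (hZB : ∀ K t, |t| ≤ l₀ → Z (K + 1) t = ∑ τ' ∈ T₀ K,
      fixW F (fun _ => linProfile (1 / 2)) NW₀ (fun _ _ => 0) (fun _ _ => 0) (fun _ _ _ => ⟨0, 0⟩) (fun _ _ _ => Pol.small)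
        (fun _ _ _ => 1) (fun _ _ _ _ => 0) (fun K => K + 1) RB K t τ')
    (hpos : ∀ K t, |t| ≤ l₀ → 0 < ∑ τ' ∈ T₀ K,
      fixW F (fun _ => linProfile (1 / 2)) NW₀ (fun _ _ => 0) (fun _ _ => 0) (fun _ _ _ => ⟨0, 0⟩) (fun _ _ _ => Pol.small)
        (fun _ _ _ => 1) (fun _ _ _ _ => 0) (fun K => K) RA K t τ')
    (hδ : Summable δ) {c : ℕ → ℝ}
    (hsw : ∀ K t, |t| ≤ l₀ → ∀ τ' ∈ T₀ K \ Bad₀ K t,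
      (∀ᵐ V ∂fieldMeasure (F.P (NW₀ τ')) 0 (SU N),
          Real.exp (c K - vol * δ K) * (oldDensity F (expMeanLogSU : LoopAverage (SU N)) K (NW₀ τ') (RA K t τ') V : ℝ) ≤
            (oldDensity F (expMeanLogSU : LoopAverage (SU N)) (K + 1) (NW₀ τ') (RB K t τ') V : ℝ)) ∧
        (∀ᵐ V ∂fieldMeasure (F.P (NW₀ τ')) 0 (SU N),
          (oldDensity F (expMeanLogSU : LoopAverage (SU N)) (K + 1) (NW₀ τ') (RB K t τ') V : ℝ) ≤
            Real.exp (c K + vol * δ K) * (oldDensity F (expMeanLogSU : LoopAverage (SU N)) K (NW₀ τ') (RA K t τ') V : ℝ))) :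
    MatchingModConstants vol l₀ (hybridDelta vol δ fun K => W K + 0) Z ∧
      Summable (hybridDelta vol δ fun K => W K + 0) ∧
      (∀ t : ℝ, |t| ≤ l₀ → CauchySeq fun K => genFun Z K t) ∧
      TendstoUniformlyOn (fun K t => genFun Z K t) (genFunLim Z) Filter.atTop {t | |t| ≤ l₀} := by
  -- `cauchy_of_finest_patterned` with ZERO declared letters: every letter binder is vacuous, the band weight is `0`
  have hχ : ∀ a : ℕ, LipProfile ((fun _ : ℕ => linProfile (1 / 2)) a) ((fun _ : ℕ => (1 / 2 : ℝ)) a)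
      ((fun _ : ℕ => (1 / 2 : ℝ)⁻¹) a) := fun _ => linProfile_lipProfile (by norm_num) (by norm_num)
  have e : (fun K => W K + ∑ a ∈ range (0 + 1), ((fun _ : ℕ => (0 : ℕ)) a : ℝ) *
      lipWeight (fun _ : ℕ => (1 / 2 : ℝ)⁻¹) (fun _ => 2) (fun _ : ℕ => (0 : ℝ)) a K) = fun K => W K + 0 := by
    funext K
    simp
  have hlt : ∀ K, W K + ∑ a ∈ range (0 + 1), ((fun _ : ℕ => (0 : ℕ)) a : ℝ) *
      lipWeight (fun _ : ℕ => (1 / 2 : ℝ)⁻¹) (fun _ => 2) (fun _ : ℕ => (0 : ℝ)) a K < 1 := fun K => by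
    have := hW.lt_one K
    simpa using this
  have main := cauchy_of_finest_patterned F (T₀ := T₀) (Bad₀ := Bad₀) (W := W) (δ := δ) (ρ := fun _ => 0)
    (N₀ := 0) (n := fun _ => 0) (m₀ := fun _ _ => 0) (slot₀ := fun _ _ _ => ⟨0, 0⟩) (fpol := fun _ _ _ => Pol.small)
    (θ₀ := fun _ _ _ => 1) (vA := fun _ _ _ _ => 0) (vB := fun _ _ _ _ => 0) hχ hNW
    (fun _ _ _ i hi => absurd hi (Nat.not_lt_zero i)) (fun _ _ _ i hi => absurd hi (Nat.not_lt_zero i))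
    (fun _ _ _ j hj => absurd hj (Nat.not_lt_zero j)) (fun _ _ _ i hi => absurd hi (Nat.not_lt_zero i))
    (fun _ _ _ i hi => absurd hi (Nat.not_lt_zero i)) (fun _ _ _ i hi => absurd hi (Nat.not_lt_zero i))
    hRA0 hRAi hRB0 hRBi hW hvol hl₀ (fun _ => le_rfl) summable_zero hlt hZA hZB hpos hδ hsw
  rw [e] at main
  exact main

end Letterless

/-! ## §4 The (η)-layer of the two runs: the `core` datum from the LOCALISED old-density sandwich -/

section Layer

variable {ι₀ Dat Sit : Type*} [DecidableEq ι₀] {N : ℕ} [NeZero N] (F : T4Family)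

/-- **THE LAYER'S CORE SANDWICH FROM THE LOCALISED OLD-DENSITY SANDWICH.**  For the (η)-layer of `T4PatternLayer`: if, for every
good layered term `τ = (τ', S)`, the two runs' OLD DENSITIES are sandwiched at a.e. window configuration `V` lying in the term's
joint polarity event (every declared letter of pattern `S` «on» in both runs — for the all-small pattern: `V` in the COMMON
SMALL-FIELD REGION of the declared window letters), then the layer's core pieces are sandwiched with a `t`-free constant per `K`:
the `hcore`/`core` datum of `T4IndicatorShell.cauchy_of_relWeightBound_shell` and of `T4MatchingAssembly.HybridNE7` for the layer
families, to be paired with END-W/END-R's `ShellWeightBound` (p206673).  Window representations by name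
(`NE7cSmoothingSocket.termRepr_window_layer_A/_B`). [folklore] -/
theorem coreSandwich_layer_local {l₀ vol : ℝ} {T₀ : ℕ → Finset ι₀} {χ : ℕ → ℝ → ℝ} {κ Lχ : ℕ → ℝ}
    (hχ : ∀ a, LipProfile (χ a) (κ a) (Lχ a)) {N₀ : ℕ} {n : ℕ → ℕ}
    {NW₀ : ι₀ → ℕ} (hNW : ∀ K, ∀ τ' ∈ T₀ K, NW₀ τ' ≤ K) {m₀ : ℕ → ι₀ → ℕ} {slot₀ : ℕ → ι₀ → ℕ → Σ _ : ℕ, ℕ}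
    (hwin : ∀ K, ∀ τ' ∈ T₀ K, ∀ i < m₀ K τ', slot₀ K τ' i ∈ (range (N₀ + 1)).sigma fun a => range (n a))
    (hband : ∀ K, ∀ τ' ∈ T₀ K, ∀ i < m₀ K τ', (slot₀ K τ' i).1 ≤ K)
    {fpol : ℕ → ι₀ → ℕ → Pol} {θ₀ : ℕ → ι₀ → ℕ → ℝ} (hθ : ∀ K, ∀ τ' ∈ T₀ K, ∀ i < m₀ K τ', 0 < θ₀ K τ' i)
    {vA vB : (K : ℕ) → (τ' : ι₀) → ℕ → GaugeField (F.P (NW₀ τ')) 0 (SU N) → ℝ}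
    (hvm : ∀ K, ∀ τ' ∈ T₀ K, ∀ i < m₀ K τ', Measurable (vA K τ' i) ∧ Measurable (vB K τ' i))
    {RA : (K : ℕ) → ℝ → ι₀ → GaugeField (F.P K) 0 (SU N) → ℝ}
    {RB : (K : ℕ) → ℝ → ι₀ → GaugeField (F.P (K + 1)) 0 (SU N) → ℝ}
    (hRA0 : ∀ K t, |t| ≤ l₀ → ∀ τ' ∈ T₀ K, 0 ≤ᵐ[fieldMeasure (F.P K) 0 (SU N)] RA K t τ')
    (hRAi : ∀ K t, |t| ≤ l₀ → ∀ τ' ∈ T₀ K, Integrable (RA K t τ') (fieldMeasure (F.P K) 0 (SU N)))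
    (hRB0 : ∀ K t, |t| ≤ l₀ → ∀ τ' ∈ T₀ K, 0 ≤ᵐ[fieldMeasure (F.P (K + 1)) 0 (SU N)] RB K t τ')
    (hRBi : ∀ K t, |t| ≤ l₀ → ∀ τ' ∈ T₀ K, Integrable (RB K t τ') (fieldMeasure (F.P (K + 1)) 0 (SU N)))
    {Bad : ℕ → ℝ → Finset (ι₀ × Finset ℕ)} {δ c : ℕ → ℝ}
    (hswL : ∀ K t, |t| ≤ l₀ → ∀ τ ∈ layerT₂ T₀ m₀ K \ Bad K t,
      (∀ᵐ V ∂fieldMeasure (F.P (NW₀ τ.1)) 0 (SU N),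
        (∀ i < m₀ K τ.1, facAt χ (slot₀ K τ.1) (layerPol₂ m₀ fpol K τ) (θ₀ K τ.1) (fun j => vA K τ.1 j V) i ≠ 0 ∧
            facAt χ (slot₀ K τ.1) (layerPol₂ m₀ fpol K τ) (θ₀ K τ.1) (fun j => vB K τ.1 j V) i ≠ 0) →
          Real.exp (c K - vol * δ K) * (oldDensity F (expMeanLogSU : LoopAverage (SU N)) K (NW₀ τ.1) (RA K t τ.1) V : ℝ) ≤
            (oldDensity F (expMeanLogSU : LoopAverage (SU N)) (K + 1) (NW₀ τ.1) (RB K t τ.1) V : ℝ)) ∧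
      (∀ᵐ V ∂fieldMeasure (F.P (NW₀ τ.1)) 0 (SU N),
        (∀ i < m₀ K τ.1, facAt χ (slot₀ K τ.1) (layerPol₂ m₀ fpol K τ) (θ₀ K τ.1) (fun j => vA K τ.1 j V) i ≠ 0 ∧
            facAt χ (slot₀ K τ.1) (layerPol₂ m₀ fpol K τ) (θ₀ K τ.1) (fun j => vB K τ.1 j V) i ≠ 0) →
          (oldDensity F (expMeanLogSU : LoopAverage (SU N)) (K + 1) (NW₀ τ.1) (RB K t τ.1) V : ℝ) ≤
            Real.exp (c K + vol * δ K) *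
              (oldDensity F (expMeanLogSU : LoopAverage (SU N)) K (NW₀ τ.1) (RA K t τ.1) V : ℝ))) :
    ∀ K : ℕ, ∃ c' : ℝ, ∀ t : ℝ, |t| ≤ l₀ → ∀ τ ∈ layerT₂ T₀ m₀ K \ Bad K t,
      Real.exp (c' - vol * δ K) *
          (layerX₂ F χ NW₀ m₀ m₀ slot₀ fpol θ₀ vA (fun K => K) RA K t τ -
            shellW χ (fun _ τ => fieldMeasure (F.P (NW₀ τ.1)) 0 (SU N)) (layerM₂ m₀) (layerSlot₂ slot₀) (layerPol₂ m₀ fpol)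
              (layerThr θ₀) (layerVar₂ vA) (layerVar₂ vB)
              (fun K t τ V => (oldDensity F (expMeanLogSU : LoopAverage (SU N)) K (NW₀ τ.1) (layerRem RA K t τ) V : ℝ)) K t τ) ≤
        layerX₂ F χ NW₀ m₀ m₀ slot₀ fpol θ₀ vB (fun K => K + 1) RB K t τ -
          shellW χ (fun _ τ => fieldMeasure (F.P (NW₀ τ.1)) 0 (SU N)) (layerM₂ m₀) (layerSlot₂ slot₀) (layerPol₂ m₀ fpol)
            (layerThr θ₀) (layerVar₂ vB) (layerVar₂ vA)
            (fun K t τ V => (oldDensity F (expMeanLogSU : LoopAverage (SU N)) (K + 1) (NW₀ τ.1) (layerRem RB K t τ) V : ℝ)) K t τ ∧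
      layerX₂ F χ NW₀ m₀ m₀ slot₀ fpol θ₀ vB (fun K => K + 1) RB K t τ -
          shellW χ (fun _ τ => fieldMeasure (F.P (NW₀ τ.1)) 0 (SU N)) (layerM₂ m₀) (layerSlot₂ slot₀) (layerPol₂ m₀ fpol)
            (layerThr θ₀) (layerVar₂ vB) (layerVar₂ vA)
            (fun K t τ V => (oldDensity F (expMeanLogSU : LoopAverage (SU N)) (K + 1) (NW₀ τ.1) (layerRem RB K t τ) V : ℝ)) K t τ ≤
        Real.exp (c' + vol * δ K) *
          (layerX₂ F χ NW₀ m₀ m₀ slot₀ fpol θ₀ vA (fun K => K) RA K t τ -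
            shellW χ (fun _ τ => fieldMeasure (F.P (NW₀ τ.1)) 0 (SU N)) (layerM₂ m₀) (layerSlot₂ slot₀) (layerPol₂ m₀ fpol)
              (layerThr θ₀) (layerVar₂ vA) (layerVar₂ vB)
              (fun K t τ V => (oldDensity F (expMeanLogSU : LoopAverage (SU N)) K (NW₀ τ.1) (layerRem RA K t τ) V : ℝ)) K t τ) :=
  core_sandwich_local (termRepr_window_layer_A F hχ hNW hwin hband hθ hvm hRA0 hRAi)
    (termRepr_window_layer_B F hχ hNW hwin hband hθ hvm hRB0 hRBi) hswL

end Layer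

end Summit.QuantumFields.BalabanUV.T4Continuum.NE7cSmoothingLocal

end
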